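import Summits.ValiantsHypothesis.ValiantsHypothesis.Theorems.NNDivisionHard.Negative.WeakReliefBlind

/-!
# The weak-relief blindness identity, part 2 (§2): the UNTILTED diagonal rows of the permutahedral passenger `Q^Π_λ` are blind for `λ ≥ n+1`
# (crux `FifoMatching.NNDivisionHard`, stmt-ValiantsHypothesis-21181; Negative-lane port of val-idea-39 g4's crux workfile, part 2/2)

PORT NOTE (val-port-3 g3, desk val-lit g14 RULING #365 (B); critic of record val-idea-crit-9 g2 GO of record; author val-idea-39 g4's staged bytes
`pub/ideators/val-idea-39/lmr/staged/g4-WeakReliefBlind/WeakReliefBlind.lean` sha16 055c24f1cd1da07d = the crux workfile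
`Cruxes/NNDivisionHard/WeakReliefBlind39.lean` rev 2 @a9c8fb5f1d4d (928aac523a62222f) modulo namespace): texts VERBATIM BY NAME; the ONLY changes are eight one-line docstrings on helper lemmas (gate lint) and the
400-line-cap SPLIT — `…/Negative/WeakReliefBlind.lean` = §1 (the weak-relief identity), this file = §2 (the untilted permutahedral rows), importing §1.  ALL CREDIT: val-idea-39 g4.
The author's §2 docstring follows verbatim.  VP ≠ VNP is NOT proved; the crux `NNDivisionHard` and C⁺_entry stay OPEN.
-/

-- the mandated summit-side namespace repeats a component by design (single-problem summit)
set_option linter.dupNamespace false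

namespace Summit.ValiantsHypothesis.Theorems.NNDivisionHardNegative.WeakReliefBlind

open Finset
open Summit.ValiantsHypothesis.Theorems.NNDivisionHardNegative.BlindCubeIdentity
  (ind ind_nonneg ind_le_one ind_mul_self ind_inter sum_ind sum_ind_mul sum_ite_eq_sub)

/-! ## §2  First located application: the UNTILTED diagonal rows of the permutahedral passenger `Q^Π_λ` are blind for `λ ≥ n+1`

THE OPEN QUESTION OF WAVE 6 (critic of record val-idea-crit-9 g2, 2026-08-28T22:52:44Z; raised by val-idea-41 g3 22:50:44Z):
is the diagonal permutahedron `Q^Π_λ = conv{−λ·diag π : π ∈ S_n}` blind to located pencils?  By crit-9's reduction the untilted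
clique row `a` has located-pencil slack `M_λ(a; b, π) = (1 − |a∩b|)² + λ·inv(a;π)` at the column `(b, π)`, where
`inv(a;π) = #{(l ∈ a, l′ ∉ a) : π(l′) < π(l)}` is the assignment recourse of `π` against the row's private optimum
(«a occupies the first |a| positions»); 41 g3: «KW/fooling give nothing»; crit-9: «(P-side) a corruption bound rank₊ M_{a,0} ≥ 2^{n^ε}
— then Q^Π_λ is DECIDED».  ★ `permInv_identity` / `permInv_rankPlus_le` below CLOSE THE P-SIDE FOR THE UNTILTED ROWS when `λ ≥ n+1`:
`rank₊ M_λ ≤ (n+1)·(4n² + 4n + 1)`, by an explicit integer certificate whose LOCATED SET is the initial segment `P_k(π) = {l : π(l) < k}`,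
`k = |a|` — the weak-relief identity of §1 at `(α, β) = (1, |a|)` supplies `(1−|a∩b|)² + (k+1)·d` (`d = |a ∖ P_k(π)| = |P_k(π) ∖ a|`), and
`λ·inv(a;π) − (k+1)·d = λ·(E₁ + E₂) + (λ − k − 1)·d² + (k+1)·d(d−1)` is a sum of nonnegative row×column products because EVERY pair
`(l ∈ a∖P, l′ ∈ P∖a)` is an inversion (`d²` of them) and at `d = 1` the single boundary swap already pays `λ ≥ k+1 = α + β`
(`E₁`, `E₂` = inversions inside `Pᶜ×Pᶜ` and `P×P`; pairs `P × Pᶜ` are never inversions).  The threshold is where it should be: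
for `λ ≤ k` the certificate is short at the boundary-swap columns, and `λ ∈ {1, …, |a|}` is what remains of the untilted question.
What this does NOT do: tilted rows `(a, σ)` (slack `(1−|a∩b|)² + Σ_i(σ_i⁺(1−b_i) + σ_i⁻ b_i) + λ·Σ_{l,l′}(v_l − v_{l′})⁺[π(l′)<π(l)]`,
`v = 𝟙_a + σ`) are NOT covered, so `LocatedPencilLaw` is neither refuted nor confirmed at `Q^Π`; paper reduction for R1 (threshold
rounding `ξ ∈ [0,1]`, `u_l = min(σ_l⁻,1)` on `a`, `w_l′ = min(σ_l′⁺,1)` off `a`, antithetic coupling `E_ξ[(1−u−w)⁺-pattern]` exact): it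
suffices to factor the `{0,1}`-tilt family `(1 − |a₀∩b|)² + |c ∖ b| + λ·#{(l ∈ a₀, l′ ∉ a₀ ∪ c) : π(l′) < π(l)}` over rows `(a₀, c)`
(`c ⊆ [n]∖a₀` the raised outsiders; cancelled elements of `a` only add cone terms) — `c = ∅` is this section, `c = [n]∖a₀` is cone by
`t − t_min = |a₀ᶜ ∩ bᶜ|` on size blocks; the mixed case is open.  VP ≠ VNP is NOT proved. -/

section Permutahedron
variable {n : ℕ}

/-- indicator of the located initial segment: `[π(l) < k]` -/
def pInd (π : Equiv.Perm (Fin n)) (k : ℕ) (l : Fin n) : ℤ := if (π l : ℕ) < k then 1 else 0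

/-- the located set `P_k(π) = {l : π(l) < k}` -/
def posLT (π : Equiv.Perm (Fin n)) (k : ℕ) : Finset (Fin n) := Finset.univ.filter fun l => (π l : ℕ) < k

/-- inversion indicator `[π(l′) < π(l)]` -/
def invInd (π : Equiv.Perm (Fin n)) (l l' : Fin n) : ℤ := if π l' < π l then 1 else 0

/-- the assignment recourse of the untilted row `a` at the permutation `π`: `inv(a;π) = #{(l ∈ a, l′ ∉ a) : π(l′) < π(l)}`
(written as a double indicator sum over `ℤ`). -/
def inv (a : Finset (Fin n)) (π : Equiv.Perm (Fin n)) : ℤ := ∑ l, ∑ l', ind a l * (1 - ind a l') * invInd π l l'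

/-- The indicator of `posLT π k` is `pInd π k`. (docstring added in the port) -/
theorem ind_posLT (π : Equiv.Perm (Fin n)) (k : ℕ) (l : Fin n) : ind (posLT π k) l = pInd π k l := by
  simp [ind, posLT, pInd]

/-- `pInd ≥ 0`. (docstring added in the port) -/
theorem pInd_nonneg (π : Equiv.Perm (Fin n)) (k : ℕ) (l : Fin n) : 0 ≤ pInd π k l := by
  unfold pInd; split_ifs <;> norm_num

/-- `pInd ≤ 1`. (docstring added in the port) -/
theorem pInd_le_one (π : Equiv.Perm (Fin n)) (k : ℕ) (l : Fin n) : pInd π k l ≤ 1 := by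
  unfold pInd; split_ifs <;> norm_num

/-- `pInd` is idempotent. (docstring added in the port) -/
theorem pInd_mul_self (π : Equiv.Perm (Fin n)) (k : ℕ) (l : Fin n) : pInd π k l * pInd π k l = pInd π k l := by
  unfold pInd; split_ifs <;> norm_num

/-- `invInd ≥ 0`. (docstring added in the port) -/
theorem invInd_nonneg (π : Equiv.Perm (Fin n)) (l l' : Fin n) : 0 ≤ invInd π l l' := by
  unfold invInd; split_ifs <;> norm_num

/-- `|P_k(π)| = k` for `k ≤ n`. -/
theorem card_posLT (π : Equiv.Perm (Fin n)) {k : ℕ} (hk : k ≤ n) : (posLT π k).card = k := by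
  have h1 : posLT π k = (Finset.univ.filter fun m : Fin n => (m : ℕ) < k).map π.symm.toEmbedding := by
    ext l
    simp only [posLT, Finset.mem_filter, Finset.mem_univ, true_and, Finset.mem_map, Equiv.coe_toEmbedding]
    constructor
    · intro h; exact ⟨π l, h, by simp⟩
    · rintro ⟨m, hm, rfl⟩; simpa using hm
  rw [h1, Finset.card_map]
  have h2 : (Finset.univ.filter fun m : Fin n => (m : ℕ) < k).card = Fintype.card {m : Fin n // (m : ℕ) < k} :=
    (Fintype.card_subtype _).symm
  rw [h2]
  exact Fintype.card_fin_lt_of_le hk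

/-- per-pair location of inversions relative to `P = P_k(π)`: a pair `(l ∉ P, l′ ∈ P)` is ALWAYS an inversion, a pair
`(l ∈ P, l′ ∉ P)` NEVER is. -/
theorem invInd_split (π : Equiv.Perm (Fin n)) (k : ℕ) (l l' : Fin n) :
    invInd π l l' = (1 - pInd π k l) * pInd π k l' +
      ((1 - pInd π k l) * (1 - pInd π k l') + pInd π k l * pInd π k l') * invInd π l l' := by
  unfold invInd pInd
  have hll' : π l' < π l ↔ ((π l' : ℕ)) < (π l : ℕ) := Fin.lt_def
  by_cases h1 : (π l : ℕ) < k <;> by_cases h2 : (π l' : ℕ) < k <;> by_cases h3 : π l' < π l <;>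
    simp only [h1, h2, h3, if_true, if_false] <;> (try norm_num) <;> (rw [hll'] at h3; omega)

/-- row factors of the two recourse families are nonnegative when `λ ≥ |a| + 1`. -/
theorem recRow_nonneg {lam : ℤ} {a : Finset (Fin n)} (hlam : (a.card : ℤ) + 1 ≤ lam) (l l₂ : Fin n) :
    0 ≤ lam * (ind a l * (1 - ind a l₂)) ∧
      0 ≤ ind a l * ind a l₂ * (lam - ((a.card : ℤ) + 1) * (if l = l₂ then 1 else 0)) := by
  have h0 := ind_nonneg a; have h1 := ind_le_one a
  have hk : (0 : ℤ) ≤ (a.card : ℤ) := Nat.cast_nonneg _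
  refine ⟨mul_nonneg (by linarith) (mul_nonneg (h0 l) (by linarith [h1 l₂])), mul_nonneg (mul_nonneg (h0 l) (h0 l₂)) ?_⟩
  split_ifs <;> linarith

/-- ★★ **THE UNTILTED PERMUTAHEDRAL IDENTITY** (all `n`, all `λ`, every row `a` and column `(b, π)`; sorry-free):
`(1 − |a∩b|)² + λ·inv(a;π) = Σ_WIdx weakRow 1 |a| a · weakCol b P_{|a|}(π)`   (weak relief located at the initial segment)
` + Σ_{l,l′} λ X_l(1−X_{l′}) · ([l,l′ ∉ P] + [l,l′ ∈ P])[π(l′)<π(l)]`   (inversions inside `Pᶜ×Pᶜ` and `P×P`)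
` + Σ_{l,l₂} X_l X_{l₂}(λ − (|a|+1)[l=l₂]) · [l ∉ P][l₂ ∉ P]`   (`λd² − (k+1)d`, paid by the `d²` boundary inversions). -/
theorem permInv_identity (lam : ℤ) (a b : Finset (Fin n)) (π : Equiv.Perm (Fin n)) :
    (1 - ((a ∩ b).card : ℤ)) ^ 2 + lam * inv a π =
      (∑ idx : WIdx n, weakRow 1 (a.card : ℤ) a idx * weakCol b (posLT π a.card) idx) +
      ((∑ l, ∑ l', (lam * (ind a l * (1 - ind a l'))) *
          ((((1 - pInd π a.card l) * (1 - pInd π a.card l') + pInd π a.card l * pInd π a.card l') * invInd π l l'))) +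
       (∑ l, ∑ l₂, (ind a l * ind a l₂ * (lam - ((a.card : ℤ) + 1) * (if l = l₂ then 1 else 0))) *
          ((1 - pInd π a.card l) * (1 - pInd π a.card l₂)))) := by
  classical
  rw [← weak_identity]
  simp only [weakLHS]
  have hkn : a.card ≤ n := by simpa using Finset.card_le_univ a
  have hPk : ((posLT π a.card).card : ℤ) = (a.card : ℤ) := by exact_mod_cast card_posLT π hkn
  have sXP : ∑ l, ind a l * pInd π a.card l = ((a ∩ posLT π a.card).card : ℤ) := by
    simp_rw [← ind_posLT]; exact sum_ind_mul a _
  have sP : ∑ l, pInd π a.card l = ((posLT π a.card).card : ℤ) := by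
    simp_rw [← ind_posLT]; exact sum_ind _
  have sX := sum_ind a
  have hX2 := ind_mul_self a
  have hP2 := pInd_mul_self π a.card
  -- (1) the recourse splits along `P`
  have hinv : inv a π =
      (∑ l, ind a l * (1 - pInd π a.card l)) * (∑ l', (1 - ind a l') * pInd π a.card l') +
      ∑ l, ∑ l', ind a l * (1 - ind a l') *
        (((1 - pInd π a.card l) * (1 - pInd π a.card l') + pInd π a.card l * pInd π a.card l') * invInd π l l') := by
    unfold inv
    rw [Finset.sum_mul_sum, ← Finset.sum_add_distrib]
    refine Finset.sum_congr rfl fun l _ => ?_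
    rw [← Finset.sum_add_distrib]
    refine Finset.sum_congr rfl fun l' _ => ?_
    conv_lhs => rw [invInd_split π a.card l l']
    ring
  -- (2) the boundary family is `λ x² − (k+1) x`, `x = Σ X_l (1 − Π_l)`
  have hbd : ∑ l, ∑ l₂, (ind a l * ind a l₂ * (lam - ((a.card : ℤ) + 1) * (if l = l₂ then 1 else 0))) *
        ((1 - pInd π a.card l) * (1 - pInd π a.card l₂)) =
      lam * (∑ l, ind a l * (1 - pInd π a.card l)) ^ 2 - ((a.card : ℤ) + 1) * ∑ l, ind a l * (1 - pInd π a.card l) := by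
    have e : ∀ l l₂, (ind a l * ind a l₂ * (lam - ((a.card : ℤ) + 1) * (if l = l₂ then 1 else 0))) *
        ((1 - pInd π a.card l) * (1 - pInd π a.card l₂)) =
        lam * ((ind a l * (1 - pInd π a.card l)) * (ind a l₂ * (1 - pInd π a.card l₂))) -
          ((a.card : ℤ) + 1) * (if l = l₂ then (ind a l * (1 - pInd π a.card l)) * (ind a l₂ * (1 - pInd π a.card l₂)) else 0) := by
      intro l l₂; split_ifs <;> ring
    have idem : ∀ l, (ind a l * (1 - pInd π a.card l)) * (ind a l * (1 - pInd π a.card l)) = ind a l * (1 - pInd π a.card l) := by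
      intro l
      linear_combination ((1 - pInd π a.card l) * (1 - pInd π a.card l)) * hX2 l + ind a l * hP2 l
    have inner : ∀ l, ∑ l₂, (ind a l * ind a l₂ * (lam - ((a.card : ℤ) + 1) * (if l = l₂ then 1 else 0))) *
        ((1 - pInd π a.card l) * (1 - pInd π a.card l₂)) =
        lam * ((ind a l * (1 - pInd π a.card l)) * ∑ l₂, ind a l₂ * (1 - pInd π a.card l₂)) -
          ((a.card : ℤ) + 1) * (ind a l * (1 - pInd π a.card l)) := by
      intro l
      rw [Finset.sum_congr rfl (fun l₂ _ => e l l₂), Finset.sum_sub_distrib, ← Finset.mul_sum, ← Finset.mul_sum,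
        ← Finset.mul_sum, Finset.sum_ite_eq]
      simp only [Finset.mem_univ, if_true]
      rw [idem l]
    rw [Finset.sum_congr rfl (fun l _ => inner l), Finset.sum_sub_distrib, ← Finset.mul_sum, ← Finset.mul_sum,
      ← Finset.sum_mul, sq]
  have hE : ∑ l, ∑ l', (lam * (ind a l * (1 - ind a l'))) *
        ((((1 - pInd π a.card l) * (1 - pInd π a.card l') + pInd π a.card l * pInd π a.card l') * invInd π l l')) =
      lam * ∑ l, ∑ l', ind a l * (1 - ind a l') *
        (((1 - pInd π a.card l) * (1 - pInd π a.card l') + pInd π a.card l * pInd π a.card l') * invInd π l l') := by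
    rw [Finset.mul_sum]
    refine Finset.sum_congr rfl fun l _ => ?_
    rw [Finset.mul_sum]
    exact Finset.sum_congr rfl fun l' _ => by ring
  rw [hinv, hbd, hE]
  -- (3) bookkeeping: x = k − |a∩P| = y
  have hx : ∑ l, ind a l * (1 - pInd π a.card l) = (a.card : ℤ) - ((a ∩ posLT π a.card).card : ℤ) := by
    rw [← sX, ← sXP, ← Finset.sum_sub_distrib]
    exact Finset.sum_congr rfl fun l _ => by ring
  have hy : ∑ l', (1 - ind a l') * pInd π a.card l' = ((posLT π a.card).card : ℤ) - ((a ∩ posLT π a.card).card : ℤ) := by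
    rw [← sP, ← sXP, ← Finset.sum_sub_distrib]
    exact Finset.sum_congr rfl fun l _ => by ring
  rw [hx, hy, hPk]
  ring

/-- index type of the packaged certificate: a row-size class `k ∈ {0,…,n}` times (weak-relief slots ⊕ two `n × n` recourse families);
`|PIdx n| = (n+1)(4n² + 4n + 1)`. -/
abbrev PIdx (n : ℕ) := Fin (n + 1) × (WIdx n ⊕ (Fin n × Fin n) ⊕ (Fin n × Fin n))

/-- `|PIdx n| = (n+1)(4n²+4n+1)`. (docstring added in the port) -/
theorem card_PIdx (n : ℕ) : Fintype.card (PIdx n) = (n + 1) * (4 * n ^ 2 + 4 * n + 1) := by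
  simp [PIdx, WIdx, Fintype.card_sum, Fintype.card_prod, Fintype.card_fin]; ring

/-- row factors at size class `k` -/
def permRow (lam : ℤ) (a : Finset (Fin n)) : WIdx n ⊕ (Fin n × Fin n) ⊕ (Fin n × Fin n) → ℤ
  | Sum.inl idx => weakRow 1 (a.card : ℤ) a idx
  | Sum.inr (Sum.inl (l, l')) => lam * (ind a l * (1 - ind a l'))
  | Sum.inr (Sum.inr (l, l₂)) => ind a l * ind a l₂ * (lam - ((a.card : ℤ) + 1) * (if l = l₂ then 1 else 0))

/-- column factors at size class `k` (located set `P_k(π)`) -/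
def permCol (b : Finset (Fin n)) (π : Equiv.Perm (Fin n)) (k : ℕ) : WIdx n ⊕ (Fin n × Fin n) ⊕ (Fin n × Fin n) → ℤ
  | Sum.inl idx => weakCol b (posLT π k) idx
  | Sum.inr (Sum.inl (l, l')) => ((1 - pInd π k l) * (1 - pInd π k l') + pInd π k l * pInd π k l') * invInd π l l'
  | Sum.inr (Sum.inr (l, l₂)) => (1 - pInd π k l) * (1 - pInd π k l₂)

/-- The permutahedral row factors are nonnegative for `λ ≥ |a|+1`. (docstring added in the port) -/
theorem permRow_nonneg {lam : ℤ} {a : Finset (Fin n)} (hlam : (a.card : ℤ) + 1 ≤ lam) (s) : 0 ≤ permRow lam a s := by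
  rcases s with idx | ⟨l, l'⟩ | ⟨l, l₂⟩ <;> simp only [permRow]
  · exact weakRow_nonneg le_rfl le_rfl idx
  · exact (recRow_nonneg hlam l l').1
  · exact (recRow_nonneg hlam l l₂).2

/-- The permutahedral column factors are nonnegative. (docstring added in the port) -/
theorem permCol_nonneg (b : Finset (Fin n)) (π : Equiv.Perm (Fin n)) (k : ℕ) (s) : 0 ≤ permCol b π k s := by
  have h0 := pInd_nonneg π k; have h1 := pInd_le_one π k
  rcases s with idx | ⟨l, l'⟩ | ⟨l, l₂⟩ <;> simp only [permCol]
  · exact weakCol_nonneg b _ idx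
  · refine mul_nonneg ?_ (invInd_nonneg π l l')
    nlinarith [h0 l, h1 l, h0 l', h1 l', mul_nonneg (h0 l) (h0 l'),
      mul_nonneg (by linarith [h1 l] : (0:ℤ) ≤ 1 - pInd π k l) (by linarith [h1 l'] : (0:ℤ) ≤ 1 - pInd π k l')]
  · exact mul_nonneg (by linarith [h1 l]) (by linarith [h1 l₂])

/-- the identity in packaged (class-free) form for ONE row -/
theorem permInv_identity' (lam : ℤ) (a b : Finset (Fin n)) (π : Equiv.Perm (Fin n)) :
    (1 - ((a ∩ b).card : ℤ)) ^ 2 + lam * inv a π = ∑ s, permRow lam a s * permCol b π a.card s := by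
  rw [permInv_identity lam a b π]
  simp only [Fintype.sum_sum_type, Fintype.sum_prod_type, permRow, permCol]

/-- ★★ **`rank₊[(1 − |a∩b|)² + λ·inv(a;π)] ≤ (n+1)(4n² + 4n + 1)` for every `n` and every integer `λ ≥ n + 1`**: nonnegative
`U : Finset (Fin n) → PIdx n → ℝ`, `V : Finset (Fin n) × Equiv.Perm (Fin n) → PIdx n → ℝ` with
`(1 − |a∩b|)² + λ·inv(a;π) = Σ_s U a s · V (b,π) s` for ALL rows `a ⊆ [n]` and columns `(b, π)` — the untilted diagonal rows of
`Q^Π_λ` carry NO corruption / hyperplane-separation lower bound beyond `O(n³)`. -/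
theorem permInv_rankPlus_le (n : ℕ) (lam : ℤ) (hlam : (n : ℤ) + 1 ≤ lam) :
    ∃ (U : Finset (Fin n) → PIdx n → ℝ) (V : Finset (Fin n) × Equiv.Perm (Fin n) → PIdx n → ℝ),
      (∀ a s, 0 ≤ U a s) ∧ (∀ bπ s, 0 ≤ V bπ s) ∧
      ∀ (a b : Finset (Fin n)) (π : Equiv.Perm (Fin n)),
        ((1 : ℝ) - ((a ∩ b).card : ℝ)) ^ 2 + (lam : ℝ) * (inv a π : ℝ) = ∑ s, U a s * V (b, π) s := by
  classical
  refine ⟨fun a s => if (s.1 : ℕ) = a.card then (permRow lam a s.2 : ℝ) else 0,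
    fun bπ s => (permCol bπ.1 bπ.2 (s.1 : ℕ) s.2 : ℝ), ?_, ?_, ?_⟩
  · intro a s
    dsimp only
    split_ifs
    · have hkn : a.card ≤ n := by simpa using Finset.card_le_univ a
      have hkn' : (a.card : ℤ) ≤ n := by exact_mod_cast hkn
      have : (a.card : ℤ) + 1 ≤ lam := by linarith
      exact_mod_cast permRow_nonneg this s.2
    · exact le_rfl
  · intro bπ s
    dsimp only
    exact_mod_cast permCol_nonneg bπ.1 bπ.2 _ s.2
  · intro a b π
    have hkn : a.card < n + 1 := by
      have : a.card ≤ n := by simpa using Finset.card_le_univ a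
      omega
    have h := congrArg (fun z : ℤ => (z : ℝ)) (permInv_identity' lam a b π)
    simp only [Int.cast_add, Int.cast_pow, Int.cast_sub, Int.cast_one, Int.cast_mul, Int.cast_natCast, Int.cast_sum] at h
    rw [h, Fintype.sum_prod_type]
    rw [Finset.sum_eq_single (⟨a.card, hkn⟩ : Fin (n + 1))]
    · simp
    · intro k _ hk
      have : (k : ℕ) ≠ a.card := fun e => hk (Fin.ext e)
      simp [this]
    · intro h; exact absurd (Finset.mem_univ _) h

end Permutahedron

end Summit.ValiantsHypothesis.Theorems.NNDivisionHardNegative.WeakReliefBlind
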